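import Summits.QuantumFields.YangMills.Theorems.PoincareLipschitzKnitFlatEndgameLetters
import Summits.QuantumFields.YangMills.Theorems.PoincareLipschitzKnitLadderLetters
import Summits.QuantumFields.YangMills.Theorems.PoincareLipschitzKnitFlatPackage
import HarnessLib

/-!
# Crux `HistoryTailL` (stmt-QuantumFields-19936), K2 organ — FILE K-5 «THE FLAT FORM OF THE ORGAN»: `hImproveCore ⟸ hImproveCoreFlat`
# (the twisted, gauge-born statement from the TWIST-FREE one: a unit `ℝ⁴`-valued lattice map on `ℤ³` that ALMOST minimises the FLAT Dirichlet energy in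
# every sub-box with slack `δ·(ρ+1)` and has bounded normalised energy has normalised energy `≤ ε₁` at ONE comparable scale)

Cell `ym3-torus` (YM ladder rung R3 = continuum SU(2) Yang–Mills on T³ — a RUNG, NOT the Clay problem: not d = 4, not infinite volume, not a mass gap);
LEAD seat `ym-ust-19936-w1` g9 (RULING g9-6: the K2 residue `hImprove` = `hImproveCore ∧ hLogFreeDecay`, the latter now ★w5's ✓p706915; this file strips
the TWIST from `hImproveCore`).  Helper `--supports stmt-QuantumFields-19936`; THEOREMS ONLY (0 `def`, 0 `sorry`); both organ texts written out as binders
(`hImproveCore` v0∕v1 7446c95ad8884810, `hImproveCoreFlat` v0∕v1 bac8eda30a54887f — HOME `ym-ust-19936-w1/g9/DRAFT-hImproveCore*-v0.w1g9.lean.txt`).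
COMPOSITION of ✓K-2a `PoincareLipschitzKnitFlatEndgameLetters` (`energy_le_two_mul_twist`, ★`flat_almostMin_const_slack`), ✓`PoincareLipschitzOrbitMinTwistSlack.energy_twist_le`,
✓px8 `KnitLadderLetters.card_box_three`, ✓K-1 `KnitFlatPackage.abs_add_le_of_box_subset`.  NOTHING here proves either organ: `hImproveCoreFlat` is the
compactness content of [SchoenUhlenbeck1984]-type bounded-energy regularity for (almost-)minimising maps `B³ → S³`, on the lattice — NOT in print.

THE ARITHMETIC.  Given the flat organ at `(2Λ₀ + 1, ε₁∕4)` with constants `δ, C₀F, R₀`, take `C₀ := C₀F + (36√(2Λ₀+1) + 162)∕δ + 40∕√ε₁ + 40`.  For twisted data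
with `τ₀R ≤ C₀⁻¹`: the flat energy of the top box is `≤ 2E_τ + 18τ₀²(2R+1)³ ≤ (2Λ₀ + 1)R` (`(τ₀R)² ≤ C₀⁻² ≤ 1∕486`); in every sub-box `Q_{ρ+1}(z′) ⊆ Q_R(z)` the
twisted local minimality gives FLAT almost-minimality with the constant slack `4τ₀√(N·E) + 2τ₀²N ≤ δ(ρ+1)` (§1 `slack_le_delta`: `N ≤ 81(ρ+1)³`, `E ≤ (2Λ₀+1)R`,
`ρ + 1 ≤ R`); the flat organ gives `r ∈ [R∕C₀F, R∕4]` with `E(Q_{2r}) ≤ ε₁r∕4`; back to the twisted energy by ✓`energy_twist_le` (§1 `twist_at_good_scale`: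
`τ₀r ≤ (4C₀)⁻¹`, `C₀ ≥ 40∕√ε₁ + 40` ⇒ `E_τ(Q_{2r}) ≤ ε₁r`).  The one-site optimality row of `hImproveCore` is not used.

WHAT IS PROVED (ns `…Theorems.PoincareLipschitzImproveCoreOfFlat`).
* §1 `sq_le_inv_of_le_inv`, `slack_le_delta`, `twist_at_good_scale` (pure reals).
* §2 ★★★ `hImproveCore_of_flat (hF : ⟨hImproveCoreFlat⟩) : ⟨hImproveCore⟩`.
HONEST SCOPE.  A reduction between two displayed organ texts; YM₃ on T³ is rung R3, not Clay; YM gap NOT proved; `HistoryTailL` NOT proved.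

References: R. Schoen, K. Uhlenbeck, J. Diff. Geom. 17 (1982) 307–335 [SchoenUhlenbeck1982] (§2: almost∕local minimality under compactly supported variations);
M. Giaquinta, Annals of Math. Studies 105 (1983) [Giaquinta1984] (Ch. III §1 p.64).
-/

set_option autoImplicit false

noncomputable section

open scoped BigOperators InnerProductSpace
open Finset

namespace Summit.QuantumFields.YangMills.Theorems.PoincareLipschitzImproveCoreOfFlat

open Literature.MathematicalPhysics.QuantumFieldTheory.Balaban1983to89
open B4Eq19LatticeOperators (Zd box unitVec mem_box box_mono self_mem_box)
open Summit.QuantumFields.YangMills.Theorems.PoincareLipschitzOrbitMinTwistSlack (energy_twist_le)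
open Summit.QuantumFields.YangMills.Theorems.PoincareLipschitzKnitFlatEndgame (energy_le_two_mul_twist flat_almostMin_const_slack)
open Summit.QuantumFields.YangMills.Theorems.PoincareLipschitzKnitLadderLetters (card_box_three)
open Summit.QuantumFields.YangMills.Theorems.PoincareLipschitzKnitFlatPackage (abs_add_le_of_box_subset)

/-! ## §1 Real letters -/

/-- `(τ₀R)² ≤ C₀⁻¹` and `τ₀R ≤ C₀⁻¹` from `τ₀R ≤ C₀⁻¹`, `C₀ ≥ 1`, `τ₀R ≥ 0`. [folklore] -/
theorem sq_le_inv_of_le_inv {x C₀ : ℝ} (hx0 : 0 ≤ x) (hC₀ : 1 ≤ C₀) (hx : x ≤ C₀⁻¹) : x ^ 2 ≤ C₀⁻¹ := by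
  have hC0 : 0 < C₀ := by linarith
  have hi1 : C₀⁻¹ ≤ 1 := inv_le_one_of_one_le₀ hC₀
  calc x ^ 2 = x * x := sq x
    _ ≤ C₀⁻¹ * 1 := mul_le_mul hx (hx.trans hi1) hx0 (by positivity)
    _ = C₀⁻¹ := mul_one _

/-- **THE TWIST SLACK IS `δ·(ρ+1)`**: `4τ₀√(N·T) + 2τ₀²N ≤ δ(ρ+1)` when `N ≤ 81(ρ+1)³`, `T ≤ Λ₁R`, `0 ≤ ρ + 1 ≤ R`, `τ₀R ≤ C₀⁻¹`,
`C₀ ≥ (36√Λ₁ + 162)∕δ`, `C₀ ≥ 1`. [folklore] -/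
theorem slack_le_delta {τ₀ N T Λ₁ R ρ C₀ δ : ℝ} (hτ0 : 0 ≤ τ₀) (hN : N ≤ 81 * (ρ + 1) ^ 3) (hT0 : 0 ≤ T) (hT : T ≤ Λ₁ * R)
    (hΛ : 0 ≤ Λ₁) (hρ : 0 ≤ ρ + 1) (hρR : ρ + 1 ≤ R) (hC₀ : 1 ≤ C₀) (hτR : τ₀ * R ≤ C₀⁻¹) (hδ : 0 < δ)
    (hC : (36 * Real.sqrt Λ₁ + 162) / δ ≤ C₀) :
    4 * τ₀ * Real.sqrt (N * T) + 2 * (τ₀ ^ 2 * N) ≤ δ * (ρ + 1) := by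
  have hR : 0 ≤ R := le_trans hρ hρR
  have hC0 : 0 < C₀ := by linarith
  have hx0 : 0 ≤ τ₀ * R := by positivity
  have hx2 : (τ₀ * R) ^ 2 ≤ C₀⁻¹ := sq_le_inv_of_le_inv hx0 hC₀ hτR
  have hsΛ : Real.sqrt Λ₁ ^ 2 = Λ₁ := Real.sq_sqrt hΛ
  -- `N·T ≤ (9(ρ+1)√Λ₁R)²`
  have h1 : N * T ≤ (9 * (ρ + 1) * (Real.sqrt Λ₁ * R)) ^ 2 := by
    have hNT : N * T ≤ 81 * (ρ + 1) ^ 3 * (Λ₁ * R) := mul_le_mul hN hT hT0 (by positivity)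
    have h2 : (ρ + 1) ^ 3 * R ≤ (ρ + 1) ^ 2 * R ^ 2 := by
      have : (ρ + 1) ^ 3 * R = (ρ + 1) ^ 2 * ((ρ + 1) * R) := by ring
      rw [this]; exact mul_le_mul_of_nonneg_left (by nlinarith) (sq_nonneg _)
    have h3 : 81 * (ρ + 1) ^ 3 * (Λ₁ * R) ≤ 81 * (ρ + 1) ^ 2 * R ^ 2 * Λ₁ := by
      have := mul_le_mul_of_nonneg_left h2 (show 0 ≤ 81 * Λ₁ by positivity); nlinarith
    calc N * T ≤ 81 * (ρ + 1) ^ 2 * R ^ 2 * Λ₁ := hNT.trans h3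
      _ = (9 * (ρ + 1) * (Real.sqrt Λ₁ * R)) ^ 2 := by rw [mul_pow, mul_pow, mul_pow, hsΛ]; ring
  have h2 : Real.sqrt (N * T) ≤ 9 * (ρ + 1) * (Real.sqrt Λ₁ * R) := by
    rw [← Real.sqrt_sq (by positivity : 0 ≤ 9 * (ρ + 1) * (Real.sqrt Λ₁ * R))]; exact Real.sqrt_le_sqrt h1
  have hA : 4 * τ₀ * Real.sqrt (N * T) ≤ 36 * Real.sqrt Λ₁ * C₀⁻¹ * (ρ + 1) := by
    calc 4 * τ₀ * Real.sqrt (N * T) ≤ 4 * τ₀ * (9 * (ρ + 1) * (Real.sqrt Λ₁ * R)) := mul_le_mul_of_nonneg_left h2 (by positivity)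
      _ = 36 * Real.sqrt Λ₁ * (τ₀ * R) * (ρ + 1) := by ring
      _ ≤ 36 * Real.sqrt Λ₁ * C₀⁻¹ * (ρ + 1) :=
          mul_le_mul_of_nonneg_right (mul_le_mul_of_nonneg_left hτR (by positivity)) hρ
  have hB : 2 * (τ₀ ^ 2 * N) ≤ 162 * C₀⁻¹ * (ρ + 1) := by
    have h3 : τ₀ ^ 2 * N ≤ τ₀ ^ 2 * (81 * (ρ + 1) ^ 3) := mul_le_mul_of_nonneg_left hN (sq_nonneg _)
    have h4 : τ₀ ^ 2 * (81 * (ρ + 1) ^ 3) ≤ 81 * (τ₀ * R) ^ 2 * (ρ + 1) := by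
      have hsq : (ρ + 1) ^ 2 ≤ R ^ 2 := pow_le_pow_left₀ hρ hρR 2
      have : τ₀ ^ 2 * (81 * (ρ + 1) ^ 3) = 81 * τ₀ ^ 2 * (ρ + 1) ^ 2 * (ρ + 1) := by ring
      rw [this]
      have : 81 * (τ₀ * R) ^ 2 * (ρ + 1) = 81 * τ₀ ^ 2 * R ^ 2 * (ρ + 1) := by ring
      rw [this]
      exact mul_le_mul_of_nonneg_right (mul_le_mul_of_nonneg_left hsq (by positivity)) hρ
    have h5 : 81 * (τ₀ * R) ^ 2 * (ρ + 1) ≤ 81 * C₀⁻¹ * (ρ + 1) :=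
      mul_le_mul_of_nonneg_right (mul_le_mul_of_nonneg_left hx2 (by norm_num)) hρ
    linarith
  have hsum : 36 * Real.sqrt Λ₁ * C₀⁻¹ * (ρ + 1) + 162 * C₀⁻¹ * (ρ + 1) ≤ δ * (ρ + 1) := by
    have hq : (36 * Real.sqrt Λ₁ + 162) * C₀⁻¹ ≤ δ := by
      rw [div_le_iff₀ hδ] at hC
      rw [← div_eq_mul_inv, div_le_iff₀ hC0]; linarith
    have e : 36 * Real.sqrt Λ₁ * C₀⁻¹ * (ρ + 1) + 162 * C₀⁻¹ * (ρ + 1) = ((36 * Real.sqrt Λ₁ + 162) * C₀⁻¹) * (ρ + 1) := by ring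
    rw [e]; exact mul_le_mul_of_nonneg_right hq hρ
  linarith

/-- **TWISTED ≤ FLAT AT THE GOOD SCALE**: `E_τ ≤ E + 2τ₀√(N·E) + τ₀²N ≤ ε₁r` when `E ≤ ε₁r∕4`, `N ≤ 375r³`, `τ₀r ≤ (4C₀)⁻¹`, `C₀ ≥ 40∕√ε₁ + 40`, `r ≥ 1`.
[folklore] -/
theorem twist_at_good_scale {Eτ E N τ₀ r ε₁ C₀ : ℝ} (hε₁ : 0 < ε₁) (hr : 1 ≤ r) (hτ0 : 0 ≤ τ₀) (hE0 : 0 ≤ E)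
    (hEτ : Eτ ≤ E + (2 * τ₀ * Real.sqrt (N * E) + τ₀ ^ 2 * N)) (hE : E ≤ ε₁ / 4 * r) (hN : N ≤ 375 * r ^ 3)
    (hC₀ : 40 / Real.sqrt ε₁ + 40 ≤ C₀) (hτr : τ₀ * r ≤ (4 * C₀)⁻¹) : Eτ ≤ ε₁ * r := by
  have hsε : 0 < Real.sqrt ε₁ := Real.sqrt_pos.mpr hε₁
  have hsε2 : Real.sqrt ε₁ ^ 2 = ε₁ := Real.sq_sqrt hε₁.le
  have hC0 : 40 ≤ C₀ := by
    have : 0 ≤ 40 / Real.sqrt ε₁ := by positivity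
    linarith
  have hC0' : 0 < C₀ := by linarith
  have hx0 : 0 ≤ τ₀ * r := by positivity
  -- `√(N·E) ≤ 10 r² √ε₁`
  have h1 : N * E ≤ (10 * r ^ 2 * Real.sqrt ε₁) ^ 2 := by
    have : N * E ≤ 375 * r ^ 3 * (ε₁ / 4 * r) := mul_le_mul hN hE hE0 (by positivity)
    nlinarith [sq_nonneg r]
  have h2 : Real.sqrt (N * E) ≤ 10 * r ^ 2 * Real.sqrt ε₁ := by
    rw [← Real.sqrt_sq (by positivity : 0 ≤ 10 * r ^ 2 * Real.sqrt ε₁)]; exact Real.sqrt_le_sqrt h1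
  -- `2τ₀·10r²√ε₁ = 20√ε₁·(τ₀r)·r ≤ 20√ε₁ r∕(4C₀) ≤ ε₁r∕4` since `C₀ ≥ 20∕√ε₁`
  have hA : 2 * τ₀ * Real.sqrt (N * E) ≤ ε₁ / 4 * r := by
    have hq : 20 * Real.sqrt ε₁ * (4 * C₀)⁻¹ ≤ ε₁ / 4 := by
      rw [← div_eq_mul_inv, div_le_iff₀ (by positivity)]
      have : 40 / Real.sqrt ε₁ ≤ C₀ := by linarith
      rw [div_le_iff₀ hsε] at this
      nlinarith
    calc 2 * τ₀ * Real.sqrt (N * E) ≤ 2 * τ₀ * (10 * r ^ 2 * Real.sqrt ε₁) := mul_le_mul_of_nonneg_left h2 (by positivity)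
      _ = 20 * Real.sqrt ε₁ * (τ₀ * r) * r := by ring
      _ ≤ 20 * Real.sqrt ε₁ * (4 * C₀)⁻¹ * r := mul_le_mul_of_nonneg_right (mul_le_mul_of_nonneg_left hτr (by positivity)) (by linarith)
      _ ≤ ε₁ / 4 * r := mul_le_mul_of_nonneg_right hq (by linarith)
  -- `τ₀²N ≤ 375 (τ₀r)² r ≤ 375 r∕(16C₀²) ≤ ε₁ r∕4`
  have hB : τ₀ ^ 2 * N ≤ ε₁ / 4 * r := by
    have h3 : τ₀ ^ 2 * N ≤ 375 * (τ₀ * r) ^ 2 * r := by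
      have : τ₀ ^ 2 * N ≤ τ₀ ^ 2 * (375 * r ^ 3) := mul_le_mul_of_nonneg_left hN (sq_nonneg _)
      nlinarith
    have h4 : (τ₀ * r) ^ 2 ≤ ((4 * C₀)⁻¹) ^ 2 := pow_le_pow_left₀ hx0 hτr 2
    have h5 : 375 * ((4 * C₀)⁻¹) ^ 2 ≤ ε₁ / 4 := by
      -- `C₀² ≥ 1600∕ε₁`… enough: `C₀ ≥ 40∕√ε₁` ⇒ `C₀²ε₁ ≥ 1600` ⇒ `375∕(16C₀²) ≤ 375ε₁∕25600 ≤ ε₁∕4`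
      have hc : 40 / Real.sqrt ε₁ ≤ C₀ := by linarith
      rw [div_le_iff₀ hsε] at hc
      have hc2 : 1600 ≤ (C₀ * Real.sqrt ε₁) ^ 2 := by nlinarith
      rw [mul_pow, hsε2] at hc2
      rw [inv_pow, mul_pow]
      rw [show (375 : ℝ) * ((4 : ℝ) ^ 2 * C₀ ^ 2)⁻¹ = 375 / (16 * C₀ ^ 2) by norm_num [div_eq_mul_inv]]
      rw [div_le_iff₀ (by positivity)]
      nlinarith
    nlinarith
  linarith

/-! ## §2 ★★★ The flat reduction of the organ -/

set_option maxHeartbeats 800000 in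
/-- ★★★ **THE FLAT FORM OF THE ORGAN IMPLIES THE TWISTED ONE**: `hImproveCoreFlat` (bac8eda3, VERBATIM) ⟹ `hImproveCore` (7446c95a, VERBATIM) — the
twisted local minimiser's flat energy is bounded (`≤ (2Λ₀+1)R`), it is a flat almost-minimiser with slack `δ(ρ+1)` in every sub-box once `τ₀R ≤ C₀⁻¹` with
`C₀ ≥ (36√(2Λ₀+1)+162)∕δ`, and the good flat scale is a good twisted scale once `C₀ ≥ 40∕√ε₁ + 40`. [cite: SchoenUhlenbeck1982, §2; Giaquinta1984, Ch. III §1 p.64] -/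
theorem hImproveCore_of_flat
    (hF : ∀ (Λ₀ ε₁ : ℝ), 0 < Λ₀ → 0 < ε₁ →
      ∃ (δ C₀ R₀ : ℝ), 0 < δ ∧ 1 ≤ C₀ ∧ 1 ≤ R₀ ∧
      ∀ (u : Zd 3 → EuclideanSpace ℝ (Fin 4)) (z : Zd 3) (R : ℤ),
      R₀ ≤ R →
      (∀ y, ‖u y‖ = 1) →
      (∀ (z' : Zd 3) (ρ : ℤ), 0 ≤ ρ → box z' (ρ + 1) ⊆ box z R →
      ∀ v : Zd 3 → EuclideanSpace ℝ (Fin 4), (∀ y, y ∉ box z' ρ → v y = u y) → (∀ y ∈ box z' ρ, ‖v y‖ = 1) →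
      ∑ y ∈ box z' (ρ + 1), ∑ μ : Fin 3, ‖u (y + unitVec μ) - u y‖ ^ 2 ≤
      (∑ y ∈ box z' (ρ + 1), ∑ μ : Fin 3, ‖v (y + unitVec μ) - v y‖ ^ 2) + δ * ((ρ : ℝ) + 1)) →
      (∑ y ∈ box z R, ∑ μ : Fin 3, ‖u (y + unitVec μ) - u y‖ ^ 2 ≤ Λ₀ * R) →
      ∃ r : ℤ, 1 ≤ r ∧ (R : ℝ) ≤ C₀ * r ∧ 4 * r ≤ R ∧
      ∑ y ∈ box z (2 * r), ∑ μ : Fin 3, ‖u (y + unitVec μ) - u y‖ ^ 2 ≤ ε₁ * r) :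
    ∀ (Λ₀ ε₁ : ℝ), 0 < Λ₀ → 0 < ε₁ →
    ∃ (C₀ R₀ : ℝ), 1 ≤ C₀ ∧ 1 ≤ R₀ ∧
    ∀ (u : Zd 3 → EuclideanSpace ℝ (Fin 4)) (τ : Fin 3 → Zd 3 → (EuclideanSpace ℝ (Fin 4) ≃ₗᵢ[ℝ] EuclideanSpace ℝ (Fin 4)))
    (z : Zd 3) (R : ℤ) (τ₀ : ℝ),
    R₀ ≤ R →
    (∀ y, ‖u y‖ = 1) →
    (∀ y ∈ box z (R + 1), ∀ (μ : Fin 3) (w : EuclideanSpace ℝ (Fin 4)), ‖τ μ y w - w‖ ≤ τ₀ * ‖w‖) →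
    τ₀ * (R : ℝ) ≤ C₀⁻¹ →
    (∀ y ∈ box z R,
    ‖∑ μ : Fin 3, (τ μ y (u (y + unitVec μ)) + (τ μ (y - unitVec μ)).symm (u (y - unitVec μ)))‖ • u y =
    ∑ μ : Fin 3, (τ μ y (u (y + unitVec μ)) + (τ μ (y - unitVec μ)).symm (u (y - unitVec μ)))) →
    (∀ (z' : Zd 3) (R' : ℤ), 0 ≤ R' → box z' (R' + 1) ⊆ box z R →
    ∀ v : Zd 3 → EuclideanSpace ℝ (Fin 4), (∀ y, y ∉ box z' R' → v y = u y) → (∀ y ∈ box z' R', ‖v y‖ = 1) →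
    ∑ y ∈ box z' (R' + 1), ∑ μ : Fin 3, ‖τ μ y (u (y + unitVec μ)) - u y‖ ^ 2 ≤
    ∑ y ∈ box z' (R' + 1), ∑ μ : Fin 3, ‖τ μ y (v (y + unitVec μ)) - v y‖ ^ 2) →
    (∑ y ∈ box z R, ∑ μ : Fin 3, ‖τ μ y (u (y + unitVec μ)) - u y‖ ^ 2 ≤ Λ₀ * R) →
    ∃ r : ℤ, 1 ≤ r ∧ (R : ℝ) ≤ C₀ * r ∧ 4 * r ≤ R ∧
    ∑ y ∈ box z (2 * r), ∑ μ : Fin 3, ‖τ μ y (u (y + unitVec μ)) - u y‖ ^ 2 ≤ ε₁ * r := by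
  intro Λ₀ ε₁ hΛ₀ hε₁
  -- the flat organ at `(2Λ₀ + 1, ε₁∕4)`
  obtain ⟨δ, C₀F, R₀, hδ, hC₀F, hR₀, hF'⟩ := hF (2 * Λ₀ + 1) (ε₁ / 4) (by linarith) (by positivity)
  obtain ⟨C₀, hC₀_def⟩ : ∃ C₀ : ℝ, C₀ = C₀F + (36 * Real.sqrt (2 * Λ₀ + 1) + 162) / δ + 40 / Real.sqrt ε₁ + 40 := ⟨_, rfl⟩
  have hq1 : 0 ≤ (36 * Real.sqrt (2 * Λ₀ + 1) + 162) / δ := by positivity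
  have hq2 : 0 ≤ 40 / Real.sqrt ε₁ := by positivity
  have hC₀F' : C₀F ≤ C₀ := by rw [hC₀_def]; linarith
  have hC₀1 : 1 ≤ C₀ := le_trans hC₀F hC₀F'
  have hC₀0 : 0 < C₀ := by linarith
  have hC₀a : (36 * Real.sqrt (2 * Λ₀ + 1) + 162) / δ ≤ C₀ := by rw [hC₀_def]; linarith
  have hC₀b : 40 / Real.sqrt ε₁ + 40 ≤ C₀ := by rw [hC₀_def]; linarith
  have hC₀c : (23 : ℝ) ≤ C₀ := by rw [hC₀_def]; linarith
  refine ⟨C₀, R₀, hC₀1, hR₀, ?_⟩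
  intro u τ z R τ₀ hR hu hdef hτR _hopt hloc hE
  have hR1 : (1 : ℝ) ≤ R := le_trans hR₀ hR
  have hRpos : (0 : ℝ) < R := by linarith
  have hR0i : (0 : ℤ) ≤ R := by exact_mod_cast hRpos.le
  have hτ0 : 0 ≤ τ₀ := by
    have := hdef z (self_mem_box z (by linarith)) 0 (u z)
    have h1 : 0 ≤ τ₀ * ‖u z‖ := (norm_nonneg _).trans this
    rw [hu z, mul_one] at h1; exact h1
  have hτR1 : τ₀ * (R : ℝ) ≤ 1 := hτR.trans (inv_le_one_of_one_le₀ hC₀1)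
  -- (1) the flat energy at the top: `E ≤ 2E_τ + 6τ₀²·3·#Q_R ≤ (2Λ₀ + 1)R`
  have hsubR1 : box z R ⊆ box z (R + 1) := box_mono z (by linarith)
  have hflatR := energy_le_two_mul_twist τ hτ0 (box z R) (fun y hy μ w => hdef y (hsubR1 hy) μ w) u (fun y _ μ => hu _)
  have hcardR : ((box z R).card : ℝ) = (2 * (R : ℝ) + 1) ^ 3 := card_box_three z hR0i
  have hjunkR : (6 : ℝ) * (τ₀ ^ 2 * (((3 : ℕ) : ℝ) * ((box z R).card : ℝ))) ≤ R := by
    -- `18τ₀²(2R+1)³ ≤ 18·27·τ₀²R³ = 486(τ₀R)²R ≤ 486R∕C₀ ≤ R` for `C₀ ≥ 486`… use `C₀ ≥ 23 ⇒ C₀² ≥ 486`: `(τ₀R)² ≤ C₀⁻²`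
      -- careful: we only have `(τ₀R)² ≤ (C₀⁻¹)²`
    rw [hcardR]; push_cast
    have h1 : (2 * (R : ℝ) + 1) ^ 3 ≤ 27 * (R : ℝ) ^ 3 := by
      calc (2 * (R : ℝ) + 1) ^ 3 ≤ (3 * (R : ℝ)) ^ 3 := pow_le_pow_left₀ (by positivity) (by linarith) 3
        _ = 27 * (R : ℝ) ^ 3 := by ring
    have h2 : (τ₀ * R) ^ 2 ≤ (C₀⁻¹) ^ 2 := pow_le_pow_left₀ (by positivity) hτR 2
    have h3 : (C₀⁻¹) ^ 2 ≤ 1 / 486 := by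
      rw [inv_pow, ← one_div]; exact div_le_div_of_nonneg_left zero_le_one (by norm_num) (by nlinarith)
    calc (6 : ℝ) * (τ₀ ^ 2 * (3 * (2 * (R : ℝ) + 1) ^ 3)) ≤ 6 * (τ₀ ^ 2 * (3 * (27 * (R : ℝ) ^ 3))) := by
          gcongr
      _ = 486 * (τ₀ * R) ^ 2 * R := by ring
      _ ≤ 486 * (1 / 486) * R := mul_le_mul_of_nonneg_right (mul_le_mul_of_nonneg_left (h2.trans h3) (by norm_num)) hRpos.le
      _ = R := by ring
  have hEflat : ∑ y ∈ box z R, ∑ μ : Fin 3, ‖u (y + unitVec μ) - u y‖ ^ 2 ≤ (2 * Λ₀ + 1) * R := by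
    have : ∑ y ∈ box z R, ∑ μ : Fin 3, ‖u (y + unitVec μ) - u y‖ ^ 2 ≤
        2 * (∑ y ∈ box z R, ∑ μ : Fin 3, ‖τ μ y (u (y + unitVec μ)) - u y‖ ^ 2) + 6 * (τ₀ ^ 2 * (((3 : ℕ) : ℝ) * ((box z R).card : ℝ))) := hflatR
    nlinarith
  -- (2) flat almost-minimality with slack `δ(ρ+1)` in every sub-box
  have halmost : ∀ (z' : Zd 3) (ρ : ℤ), 0 ≤ ρ → box z' (ρ + 1) ⊆ box z R →
      ∀ v : Zd 3 → EuclideanSpace ℝ (Fin 4), (∀ y, y ∉ box z' ρ → v y = u y) → (∀ y ∈ box z' ρ, ‖v y‖ = 1) →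
        ∑ y ∈ box z' (ρ + 1), ∑ μ : Fin 3, ‖u (y + unitVec μ) - u y‖ ^ 2 ≤
          (∑ y ∈ box z' (ρ + 1), ∑ μ : Fin 3, ‖v (y + unitVec μ) - v y‖ ^ 2) + δ * ((ρ : ℝ) + 1) := by
    intro z' ρ hρ hsub v hv hv1
    have hdef' : ∀ y ∈ box z' (ρ + 1), ∀ (μ : Fin 3) (w : EuclideanSpace ℝ (Fin 4)), ‖τ μ y w - w‖ ≤ τ₀ * ‖w‖ :=
      fun y hy μ w => hdef y (hsubR1 (hsub hy)) μ w
    have hEsub : ∑ y ∈ box z' (ρ + 1), ∑ μ : Fin 3, ‖u (y + unitVec μ) - u y‖ ^ 2 ≤ (2 * Λ₀ + 1) * R :=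
      le_trans (Finset.sum_le_sum_of_subset_of_nonneg hsub fun _ _ _ => Finset.sum_nonneg fun _ _ => sq_nonneg _) hEflat
    have hv1' : ∀ y, ‖v y‖ = 1 := by
      intro y
      by_cases hy : y ∈ box z' ρ
      · exact hv1 y hy
      · rw [hv y hy]; exact hu y
    have h := flat_almostMin_const_slack τ hτ0 z' ρ hdef' u hu (hloc z' ρ hρ hsub) le_rfl v hv1' hv
    -- the slack is `≤ δ(ρ+1)`
    have hρR : (ρ : ℝ) + 1 ≤ R := by
      have := abs_add_le_of_box_subset (show (0 : ℤ) ≤ ρ + 1 by linarith) hsub 0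
      have : ρ + 1 ≤ R := by linarith [abs_nonneg (z' 0 - z 0)]
      exact_mod_cast this
    have hcard : ((box z' (ρ + 1)).card : ℝ) = (2 * (((ρ + 1 : ℤ)) : ℝ) + 1) ^ 3 := card_box_three z' (by linarith)
    have hN : (((3 : ℕ) : ℝ) * ((box z' (ρ + 1)).card : ℝ)) ≤ 81 * ((ρ : ℝ) + 1) ^ 3 := by
      rw [hcard]; push_cast
      have hρ0 : (0 : ℝ) ≤ (ρ : ℝ) := by exact_mod_cast hρ
      calc (3 : ℝ) * (2 * ((ρ : ℝ) + 1) + 1) ^ 3 ≤ 3 * (3 * ((ρ : ℝ) + 1)) ^ 3 := by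
            gcongr; linarith
        _ = 81 * ((ρ : ℝ) + 1) ^ 3 := by ring
    have hslack := slack_le_delta hτ0 hN (Finset.sum_nonneg fun _ _ => Finset.sum_nonneg fun _ _ => sq_nonneg _) hEsub
      (by linarith) (by exact_mod_cast (show (0:ℤ) ≤ ρ + 1 by linarith)) hρR hC₀1 hτR hδ hC₀a
    linarith
  -- (3) the flat organ
  obtain ⟨r, hr1, hRr, h4r, hsmall⟩ := hF' u z R hR hu halmost hEflat
  refine ⟨r, hr1, hRr.trans (mul_le_mul_of_nonneg_right hC₀F' (by exact_mod_cast (show (0:ℤ) ≤ r by linarith))), h4r, ?_⟩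
  -- (4) back to the twisted energy at the good scale
  have hr1R : (1 : ℝ) ≤ r := by exact_mod_cast hr1
  have h4rR : 4 * (r : ℝ) ≤ R := by exact_mod_cast h4r
  have hsub2r : box z (2 * r) ⊆ box z (R + 1) := box_mono z (by linarith)
  have htw := energy_twist_le τ hτ0 (box z (2 * r)) (fun y hy μ w => hdef y (hsub2r hy) μ w) u (fun y _ μ => hu _)
  have hcard2r : ((box z (2 * r)).card : ℝ) = (2 * (((2 * r : ℤ)) : ℝ) + 1) ^ 3 := card_box_three z (by linarith)
  have hN2 : (((3 : ℕ) : ℝ) * ((box z (2 * r)).card : ℝ)) ≤ 375 * (r : ℝ) ^ 3 := by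
    rw [hcard2r]; push_cast
    calc (3 : ℝ) * (2 * (2 * (r : ℝ)) + 1) ^ 3 ≤ 3 * (5 * (r : ℝ)) ^ 3 := by gcongr; linarith
      _ = 375 * (r : ℝ) ^ 3 := by ring
  have hτr : τ₀ * (r : ℝ) ≤ (4 * C₀)⁻¹ := by
    have h1 : 4 * (τ₀ * (r : ℝ)) ≤ τ₀ * R := by nlinarith
    have e : (4 * C₀)⁻¹ = C₀⁻¹ / 4 := by rw [mul_inv]; ring
    rw [e]; linarith
  exact twist_at_good_scale hε₁ hr1R hτ0 (Finset.sum_nonneg fun _ _ => Finset.sum_nonneg fun _ _ => sq_nonneg _)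
    htw hsmall hN2 hC₀b hτr

end Summit.QuantumFields.YangMills.Theorems.PoincareLipschitzImproveCoreOfFlat

end
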